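import Mathlib
import Literature.Analysis.FluidPDE.ClassicalSolution
import Literature.Analysis.FluidPDE.LerayHopf
import Literature.Analysis.FluidPDE.NSWave0
import Summits.NavierStokesRegularity.NavierStokesRegularity.Theses.L3TimeExponentPincer
import Summits.NavierStokesRegularity.NavierStokesRegularity.Theorems.L3TimeExponentPincerPaceDichotomy
import Summits.NavierStokesRegularity.NavierStokesRegularity.Theorems.L3TimeExponentPincerEffSatBlowupStubParabolicConcentrationBlowup
import HarnessLib.Audit
import HarnessLib

/-!
# `L³` concentration in parabolic balls for EVERY blow-up of the frame (Kang–Miura–Tsai 2021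
# Remark 1.7 (3); Maekawa–Miura–Prange 2020) — route `L3TimeExponentPincer`, `L³` axis

Support file for the route `L3TimeExponentPincer` (cell ns-regularity-ideate, seat p4): the critical-norm
floor on the route's `L³` axis that follows from the proved stub 1 of line `pace`
(`Cruxes.EffSatBlowup.Pace.stub_parabolicConcentration_blowup`, parabolic `L²` concentration, p423422) by
Hölder on the parabolic ball, in the form of Kang–Miura–Tsai, Pure Appl. Anal. 3 (2021) = arXiv:2006.13145,
Remark 1.7 (3) ("from (1.6) and the Hölder inequality we can also deduce the similar concentration
estimate `∫_{B_{√((T*-t)/S)}} |v(t)|³ ≥ √S ε_*`"):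

* `l3ParabolicConcentration_of_blowup` — every classical solution on `[0,T)`, Leray–Hopf from a rapidly
  decaying datum, with no smooth extension past `T`, has `γ₃ ≤ ∫_{B(x₀(t), c√(T-t))} |u(t)|³` for some
  centre `x₀(t)` at every late time (`γ₃, c > 0` independent of `t`; here `γ₃ = γ^{3/2}/(8 c^{3/2})` from the
  `L²` data `γ, c` of `ParabolicConcentration`);
* `eLpNorm_three_floor_of_blowup` — in particular `‖u(t)‖_{L³(ℝ³)} ≥ γ₃^{1/3}` on a final window: a
  UNIFORM positive floor of the critical norm before any blow-up (the exponent-`0` case of the floor stub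
  `stub_l3RateFloor` of the residual crux `SupercriticalSerrinL3`, `stmt-NavierStokesRegularity-19500`,
  whose registered form asks for a power `θ₀ > 1/5`; Escauriaza–Seregin–Šverák's `‖u(t)‖₃ → ∞` is the
  printed qualitative statement, not used here).

The Hölder step is done with the elementary Young splitting `b² ≤ b³/a + a²` (`sq_le_cube_div_add_sq`)
integrated over the ball (`lintegral_ball_sq_le_cube_div_add`, `|B_r| ≤ 8r³` from Mathlib's
`EuclideanSpace.volume_ball_fin_three`), with `a = √γ/(4 c^{3/2} √(T-t))`, so that the parabolic factors
`√(T-t)` cancel exactly.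

WHAT THIS IS NOT: not a claim about Navier–Stokes regularity or blow-up; implications between typed tree
predicates, kernel-checked, landed `--supports` as a helper; no crux is claimed or closed.
-/

noncomputable section

namespace Summit.NavierStokesRegularity.NavierStokesRegularity.Theorems.L3TimeExponentPincerL3ParabolicConcentration

open MeasureTheory Set Function Filter Metric Topology TopologicalSpace
open scoped ENNReal NNReal
open Literature.Analysis.FluidPDE
open Summit.NavierStokesRegularity.NavierStokesRegularity.Theorems.L3TimeExponentPincerPaceDichotomy
open Summit.NavierStokesRegularity.NavierStokesRegularity.Cruxes.EffSatBlowup.Pace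

/-- Young's splitting `b² ≤ b³/a + a²` for `a > 0`, `b ≥ 0` (if `b ≤ a` then `b² ≤ a²`, else
`b² = b³/b ≤ b³/a`). [folklore] -/
theorem sq_le_cube_div_add_sq {a b : ℝ} (ha : 0 < a) (hb : 0 ≤ b) : b ^ 2 ≤ b ^ 3 / a + a ^ 2 := by
  have h3 : 0 ≤ b ^ 3 / a := by positivity
  rcases le_or_gt b a with h | h
  · nlinarith [pow_le_pow_left₀ hb h 2]
  · have hb0 : 0 < b := ha.trans h
    have h1 : b ^ 2 ≤ b ^ 3 / a := by
      rw [le_div_iff₀ ha]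
      nlinarith [sq_nonneg b, mul_pos hb0 hb0]
    nlinarith [sq_nonneg a]

/-- `|B(x, r)| ≤ 8 r³` in `ℝ³` (`|B₁| = 4π/3 ≤ 8`). [folklore] -/
theorem volume_ball_le_eight_mul_cube (x : EuclideanSpace ℝ (Fin 3)) {r : ℝ} (hr : 0 ≤ r) :
    volume (ball x r) ≤ ENNReal.ofReal (8 * r ^ 3) := by
  rw [EuclideanSpace.volume_ball_fin_three, ← ENNReal.ofReal_pow hr, ← ENNReal.ofReal_mul (by positivity)]
  refine ENNReal.ofReal_le_ofReal ?_
  have hπ : Real.pi * 4 / 3 ≤ 8 := by nlinarith [Real.pi_le_four]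
  have hr3 : 0 ≤ r ^ 3 := by positivity
  nlinarith

/-- **Young/Hölder on a ball**: `∫_{B(x₀,r)} |f|² ≤ a⁻¹ ∫_{B(x₀,r)} |f|³ + 8 a² r³` for `a, r > 0`
(pointwise `|f|² ≤ |f|³/a + a²`, `|B_r| ≤ 8r³`). [folklore] -/
theorem lintegral_ball_sq_le_cube_div_add
    (f : EuclideanSpace ℝ (Fin 3) → EuclideanSpace ℝ (Fin 3)) (x₀ : EuclideanSpace ℝ (Fin 3))
    {r a : ℝ} (hr : 0 < r) (ha : 0 < a) :
    ∫⁻ x in ball x₀ r, ‖f x‖ₑ ^ 2 ≤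
      (ENNReal.ofReal a)⁻¹ * (∫⁻ x in ball x₀ r, ‖f x‖ₑ ^ 3) + ENNReal.ofReal (8 * a ^ 2 * r ^ 3) := by
  have hpt : ∀ x, ‖f x‖ₑ ^ 2 ≤ (ENNReal.ofReal a)⁻¹ * ‖f x‖ₑ ^ 3 + ENNReal.ofReal (a ^ 2) := by
    intro x
    have h1 := sq_le_cube_div_add_sq ha (norm_nonneg (f x))
    have e2 : ‖f x‖ₑ ^ 2 = ENNReal.ofReal (‖f x‖ ^ 2) := by
      rw [← ofReal_norm, ENNReal.ofReal_pow (norm_nonneg _)]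
    have e3 : (ENNReal.ofReal a)⁻¹ * ‖f x‖ₑ ^ 3 = ENNReal.ofReal (‖f x‖ ^ 3 / a) := by
      rw [← ofReal_norm, ← ENNReal.ofReal_pow (norm_nonneg _), div_eq_inv_mul,
        ENNReal.ofReal_mul (inv_nonneg.2 ha.le), ENNReal.ofReal_inv_of_pos ha]
    rw [e2, e3, ← ENNReal.ofReal_add (by positivity) (by positivity)]
    exact ENNReal.ofReal_le_ofReal h1
  calc ∫⁻ x in ball x₀ r, ‖f x‖ₑ ^ 2
      ≤ ∫⁻ x in ball x₀ r, ((ENNReal.ofReal a)⁻¹ * ‖f x‖ₑ ^ 3 + ENNReal.ofReal (a ^ 2)) :=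
        lintegral_mono fun x => hpt x
    _ = (∫⁻ x in ball x₀ r, (ENNReal.ofReal a)⁻¹ * ‖f x‖ₑ ^ 3) +
          ∫⁻ _x in ball x₀ r, ENNReal.ofReal (a ^ 2) := lintegral_add_right _ measurable_const
    _ = (ENNReal.ofReal a)⁻¹ * (∫⁻ x in ball x₀ r, ‖f x‖ₑ ^ 3) +
          ENNReal.ofReal (a ^ 2) * volume (ball x₀ r) := by
        rw [lintegral_const_mul' _ _ (ENNReal.inv_ne_top.2 (ENNReal.ofReal_pos.2 ha).ne'),
          setLIntegral_const]
    _ ≤ (ENNReal.ofReal a)⁻¹ * (∫⁻ x in ball x₀ r, ‖f x‖ₑ ^ 3) +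
          ENNReal.ofReal (a ^ 2) * ENNReal.ofReal (8 * r ^ 3) := by
        gcongr
        exact volume_ball_le_eight_mul_cube x₀ hr.le
    _ = (ENNReal.ofReal a)⁻¹ * (∫⁻ x in ball x₀ r, ‖f x‖ₑ ^ 3) + ENNReal.ofReal (8 * a ^ 2 * r ^ 3) := by
        rw [← ENNReal.ofReal_mul (by positivity)]
        congr 2
        ring

/-- **From `L²` to `L³` concentration on a parabolic ball.**  If `γ√s ≤ ∫_{B(x₀, c√s)} |f|²`
(`γ, c, s > 0`), then `γ₃ ≤ ∫_{B(x₀, c√s)} |f|³` with `γ₃ = √γ · γ / (8 c^{3/2})`, INDEPENDENT of `s`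
(Young's splitting with `a = √γ / (4 c^{3/2} √s)`).  This is the Hölder step of Kang–Miura–Tsai 2021,
Remark 1.7 (3). [cite: KangMiuraTsai2021PAA, Remark 1.7 (3) (arXiv:2006.13145 p. 5)] -/
theorem lintegral_ball_cube_ge_of_sq_ge (f : EuclideanSpace ℝ (Fin 3) → EuclideanSpace ℝ (Fin 3))
    (x₀ : EuclideanSpace ℝ (Fin 3)) {γ c s : ℝ} (hγ : 0 < γ) (hc : 0 < c) (hs : 0 < s)
    (h : ENNReal.ofReal (γ * Real.sqrt s) ≤ ∫⁻ x in ball x₀ (c * Real.sqrt s), ‖f x‖ₑ ^ 2) :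
    ENNReal.ofReal (Real.sqrt γ * γ / (8 * (c * Real.sqrt c))) ≤
      ∫⁻ x in ball x₀ (c * Real.sqrt s), ‖f x‖ₑ ^ 3 := by
  have hsq : 0 < Real.sqrt s := Real.sqrt_pos.2 hs
  have hsqγ : 0 < Real.sqrt γ := Real.sqrt_pos.2 hγ
  have hsqc : 0 < Real.sqrt c := Real.sqrt_pos.2 hc
  have hr : 0 < c * Real.sqrt s := by positivity
  -- the splitting parameter `a = √γ / (4 c √c √s)`
  set a : ℝ := Real.sqrt γ / (4 * (c * Real.sqrt c) * Real.sqrt s) with ha_def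
  have ha : 0 < a := by positivity
  set X : ℝ≥0∞ := ∫⁻ x in ball x₀ (c * Real.sqrt s), ‖f x‖ₑ ^ 3 with hX
  have hY := lintegral_ball_sq_le_cube_div_add f x₀ hr ha
  -- `8 a² (c√s)³ = γ√s/2`
  have hss : Real.sqrt s ^ 2 = s := Real.sq_sqrt hs.le
  have hcc : Real.sqrt c ^ 2 = c := Real.sq_sqrt hc.le
  have hgg : Real.sqrt γ ^ 2 = γ := Real.sq_sqrt hγ.le
  have e1 : 8 * a ^ 2 * (c * Real.sqrt s) ^ 3 = γ * Real.sqrt s / 2 := by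
    rw [ha_def]
    field_simp
    nlinarith [hss, hcc, hgg, hsq, hsqc, hsqγ, hc, hs, hγ]
  rw [e1] at hY
  -- `γ√s = γ√s/2 + γ√s/2`, cancel one half
  have hhalf : 0 ≤ γ * Real.sqrt s / 2 := by positivity
  have e2 : ENNReal.ofReal (γ * Real.sqrt s) =
      ENNReal.ofReal (γ * Real.sqrt s / 2) + ENNReal.ofReal (γ * Real.sqrt s / 2) := by
    rw [← ENNReal.ofReal_add hhalf hhalf]; congr 1; ring
  have h3 : ENNReal.ofReal (γ * Real.sqrt s / 2) + ENNReal.ofReal (γ * Real.sqrt s / 2) ≤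
      (ENNReal.ofReal a)⁻¹ * X + ENNReal.ofReal (γ * Real.sqrt s / 2) := by
    rw [← e2]; exact h.trans hY
  have h4 : ENNReal.ofReal (γ * Real.sqrt s / 2) ≤ (ENNReal.ofReal a)⁻¹ * X :=
    ENNReal.le_of_add_le_add_right ENNReal.ofReal_ne_top h3
  -- multiply by `a`: `a · γ√s/2 = √γ γ / (8 c√c)`
  have ha0 : ENNReal.ofReal a ≠ 0 := (ENNReal.ofReal_pos.2 ha).ne'
  have h5 : ENNReal.ofReal a * ENNReal.ofReal (γ * Real.sqrt s / 2) ≤ X := by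
    calc ENNReal.ofReal a * ENNReal.ofReal (γ * Real.sqrt s / 2)
        ≤ ENNReal.ofReal a * ((ENNReal.ofReal a)⁻¹ * X) := by gcongr
      _ = X := by rw [← mul_assoc, ENNReal.mul_inv_cancel ha0 ENNReal.ofReal_ne_top, one_mul]
  have e3 : a * (γ * Real.sqrt s / 2) = Real.sqrt γ * γ / (8 * (c * Real.sqrt c)) := by
    rw [ha_def]
    field_simp
    ring
  rw [← ENNReal.ofReal_mul ha.le, e3] at h5
  exact h5

/-- **`L³` concentration in parabolic balls at every blow-up of the frame** (Kang–Miura–Tsai 2021,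
Remark 1.7 (3); Maekawa–Miura–Prange 2020: `L³` concentration in `B_{c√(T*-t)}(x(t))` for all `t < T*`).
Every classical solution on `[0,T)`, Leray–Hopf from a rapidly decaying datum, with no smooth extension past
`T`, admits `γ₃, c > 0` and a final window on which, at every time `t`, some ball `B(x₀(t), c√(T-t))`
carries `∫ |u(t)|³ ≥ γ₃`.  Proof: the proved stub `stub_parabolicConcentration_blowup` (parabolic `L²`
concentration) and `lintegral_ball_cube_ge_of_sq_ge`.
[cite: KangMiuraTsai2021PAA, Thm 1.6 (i) and Remark 1.7 (3) (arXiv:2006.13145 p. 5)] -/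
theorem l3ParabolicConcentration_of_blowup {ν T : ℝ} (hν : 0 < ν) (hT : 0 < T)
    {u : ℝ → EuclideanSpace ℝ (Fin 3) → EuclideanSpace ℝ (Fin 3)} {p : ℝ → EuclideanSpace ℝ (Fin 3) → ℝ}
    (hcl : IsClassicalNSSolutionOn (Ico 0 T) ν 0 u p) (hLH : IsLerayHopfOn T ν 0 (u 0) u)
    (hdec : HasRapidSpatialDecay (u 0)) (hnext : ¬ HasSmoothExtensionPast ν 0 u T) :
    ∃ γ₃ : ℝ, 0 < γ₃ ∧ ∃ c : ℝ, 0 < c ∧ ∃ T₁ < T, ∀ t ∈ Ioo T₁ T,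
      ∃ x₀ : EuclideanSpace ℝ (Fin 3),
        ENNReal.ofReal γ₃ ≤ ∫⁻ x in ball x₀ (c * Real.sqrt (T - t)), ‖u t x‖ₑ ^ 3 := by
  obtain ⟨γ, hγ, c, hc, T₁, hT₁, h⟩ := stub_parabolicConcentration_blowup ν T hν hT u p hcl hLH hdec hnext
  refine ⟨Real.sqrt γ * γ / (8 * (c * Real.sqrt c)), by positivity, c, hc, T₁, hT₁, fun t ht => ?_⟩
  obtain ⟨x₀, hx₀⟩ := h t ht
  exact ⟨x₀, lintegral_ball_cube_ge_of_sq_ge (u t) x₀ hγ hc (sub_pos.2 ht.2) hx₀⟩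

/-- **A uniform positive floor of the critical norm before any blow-up of the frame**:
`‖u(t)‖_{L³(ℝ³)}³ ≥ γ₃ > 0` on a final window (`L³` of the whole space dominates `L³` of the
concentration ball).  The exponent-`0` case of the floor asked by `stub_l3RateFloor` of the residual crux
`SupercriticalSerrinL3` (`stmt-NavierStokesRegularity-19500`); weaker than Escauriaza–Seregin–Šverák's
`‖u(t)‖₃ → ∞`, but unconditional in the tree and with a constant depending on `ν` only.
[cite: KangMiuraTsai2021PAA, Remark 1.7 (3) (arXiv:2006.13145 p. 5)] -/
theorem eLpNorm_three_floor_of_blowup {ν T : ℝ} (hν : 0 < ν) (hT : 0 < T)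
    {u : ℝ → EuclideanSpace ℝ (Fin 3) → EuclideanSpace ℝ (Fin 3)} {p : ℝ → EuclideanSpace ℝ (Fin 3) → ℝ}
    (hcl : IsClassicalNSSolutionOn (Ico 0 T) ν 0 u p) (hLH : IsLerayHopfOn T ν 0 (u 0) u)
    (hdec : HasRapidSpatialDecay (u 0)) (hnext : ¬ HasSmoothExtensionPast ν 0 u T) :
    ∃ γ₃ : ℝ, 0 < γ₃ ∧ ∃ T₁ < T, ∀ t ∈ Ioo T₁ T,
      ENNReal.ofReal γ₃ ≤ eLpNorm (u t) 3 volume ^ (3 : ℝ) := by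
  obtain ⟨γ₃, hγ₃, c, -, T₁, hT₁, h⟩ := l3ParabolicConcentration_of_blowup hν hT hcl hLH hdec hnext
  refine ⟨γ₃, hγ₃, T₁, hT₁, fun t ht => ?_⟩
  obtain ⟨x₀, hx₀⟩ := h t ht
  have e : eLpNorm (u t) 3 volume ^ (3 : ℝ) = ∫⁻ x, ‖u t x‖ₑ ^ 3 := by
    rw [eLpNorm_eq_lintegral_rpow_enorm_toReal (by norm_num) (by norm_num), ENNReal.toReal_ofNat,
      ← ENNReal.rpow_mul, one_div, inv_mul_cancel₀ (by norm_num), ENNReal.rpow_one]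
    refine lintegral_congr fun x => ?_
    rw [show (3 : ℝ) = ((3 : ℕ) : ℝ) by norm_num, ENNReal.rpow_natCast]
  rw [e]
  exact hx₀.trans (setLIntegral_le_lintegral _ _)

end Summit.NavierStokesRegularity.NavierStokesRegularity.Theorems.L3TimeExponentPincerL3ParabolicConcentration

end
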